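import Summits.NavierStokesRegularity.OSWSelfSimilar.OSWMechanismGlobalBranch05
import HarnessLib

/-!
# OSW self-similar mechanism, companion module (MECHANISM.md §§29–34: THEOREMS M32–M39) — part 06 of 09

1-D model (gCLM/OSW), computer-assisted; not Euler/NS.  Filed under `Summits/NavierStokesRegularity/OSWSelfSimilar/` by a prover-role courier on behalf of the
mechanism seat pub-oswblow-mech (planner-pub-oswblow-mech-g29-0), cell pub-oswblow (host summit NavierStokesRegularity); the gate admits the path but
not role planner.  CONTENT = the staged transcript `pub-oswblow-mech/lean/OSWMechanismGlobalBranch.lean` (sha256 4e5de3f87ec94598…,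
2998 lines), source lines 1844–2212, UNCHANGED except: (i) namespace prefix `OSWSelfSimilar.Mechanism` → `Summit.NavierStokesRegularity.OSWSelfSimilar.Mechanism`;
(ii) the frames open at the cut (section (anonymous) › namespace Summit.NavierStokesRegularity.OSWSelfSimilar.Mechanism.FirstCritFloor) are re-opened above the body with their `open` commands replayed, and closed
at the end; (iii) this docstring.  Generated by `pub-oswblow-mech/lean/courier/make_split.py`; the parts must be filed IN ORDER
(each imports its predecessor).  First/last declarations here: `cos_half_sub_cos_eq` … `tail_slope_neg` (28 in this part).
AI-written transcript; kernel-checked on the farm as ONE file before splitting (see the kit's CHECKS); to be checked, not trusted.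
COURIER NOTE (prover-role courier seat pub-oswblow-courier g2, 2026-08-25): in addition to the changes listed above, 2 one-line docstrings were added at filing on the declarations the transcript left undocumented (tree docstring rule); each only restates the formal statement of its declaration; nothing else was touched. List of the added docstrings: HOME `pub-oswblow-courier/g2/DOCSTRINGS.tsv`.
-/

noncomputable section
open Complex Set Filter
open scoped Topology
open Literature.Analysis.FluidPDE.OkamotoSakajoWunsch2008
namespace Summit.NavierStokesRegularity.OSWSelfSimilar.Mechanism.FirstCritFloor
open Summit.NavierStokesRegularity.OSWSelfSimilar.Mechanism.GlobalBranch Summit.NavierStokesRegularity.OSWSelfSimilar.Mechanism.ChordSlope Summit.NavierStokesRegularity.OSWSelfSimilar.Mechanism.SourceDefect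
open Finset

/-- `cos(x/2) − cos x = (1 − cos(x/2))(1 + 2cos(x/2))`. -/
theorem cos_half_sub_cos_eq (x : ℝ) :
    Real.cos (x / 2) - Real.cos x = (1 - Real.cos (x / 2)) * (1 + 2 * Real.cos (x / 2)) := by
  have h := Real.cos_two_mul (x / 2)
  rw [show 2 * (x / 2) = x by ring] at h
  rw [h]; ring

/-- T₁'s constant: `2(1+c)/(1+2c) ≤ 1.34` for `c ≥ 0.99`, in product form. -/
theorem t1_ratio_le (c : ℝ) (hc : 99 / 100 ≤ c) : 2 * (1 + c) ≤ (134 / 100) * (1 + 2 * c) := by linarith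

/-- STEP 3: unrolling `M_j ≤ α_{j+1} + β_{j+1}·M_{j+1}` (β ≥ 0):
`M₀ ≤ Σ_{j<n} (Π_{i<j} β_{i+1})·α_{j+1} + (Π_{i<n} β_{i+1})·M_n`. -/
theorem bootstrap_unroll (M α β : ℕ → ℝ) (hβ : ∀ j, 0 ≤ β j) (hstep : ∀ j, M j ≤ α (j + 1) + β (j + 1) * M (j + 1))
    (n : ℕ) :
    M 0 ≤ (∑ j ∈ range n, (∏ i ∈ range j, β (i + 1)) * α (j + 1)) + (∏ i ∈ range n, β (i + 1)) * M n := by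
  induction n with
  | zero => simp
  | succ n ih =>
    rw [sum_range_succ, prod_range_succ]
    have hP : 0 ≤ ∏ i ∈ range n, β (i + 1) := prod_nonneg fun i _ => hβ (i + 1)
    have := mul_le_mul_of_nonneg_left (hstep n) hP
    nlinarith [ih, this]

/-- STEP 3, the numerical series: with `r = 0.04825 ≥ β_i` and `α_{j} ≤ k(13.52 + 2.01(j−1))`:
`Σ_{j<n} r^j (13.52 + 2.01 j) ≤ 14.35` for every `n` (so `M(2) ≤ 14.35k < 14.4k`). -/
theorem bootstrap_sum_le (n : ℕ) :
    ∑ j ∈ range n, (193 / 4000 : ℝ) ^ j * (1352 / 100 + 201 / 100 * (j : ℝ)) ≤ 1435 / 100 := by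
  suffices h : ∑ j ∈ range n, (193 / 4000 : ℝ) ^ j * (1352 / 100 + 201 / 100 * (j : ℝ))
      ≤ 1435 / 100 - (193 / 4000 : ℝ) ^ n * (1435 / 100 + 212 / 100 * (n : ℝ)) by
    have hr : 0 ≤ (193 / 4000 : ℝ) ^ n * (1435 / 100 + 212 / 100 * (n : ℝ)) := by positivity
    linarith
  induction n with
  | zero => simp
  | succ n ih =>
    rw [sum_range_succ, pow_succ]
    push_cast
    have hr : 0 ≤ (193 / 4000 : ℝ) ^ n := by positivity
    have hn : 0 ≤ (n : ℝ) := Nat.cast_nonneg n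
    nlinarith [ih, hr, hn, mul_nonneg hr hn]

/-- STEP 4: the contradiction `aA₀ = η(x_m) ≤ M(2) ≤ 14.4k`, `k < a/8`, `A₀ > 5/2`. -/
theorem tangent_height_contra (a A0 k M : ℝ) (ha : 0 < a) (hA0 : 5 / 2 < A0) (hM : a * A0 ≤ M)
    (hMk : M ≤ (144 / 10) * k) (hk : k < a / 8) : False := by
  nlinarith

/-- The second clause: `K_m ≥ min{k/4, c·aA₀}` (M34, `c = c₆/2 ≥ 1/31`), `k ≥ a/8`, `A₀ ≥ 5/2` ⇒ `K_m ≥ a/32`. -/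
theorem Km_floor_alg (k a A0 Km c : ℝ) (ha : 0 < a) (hA0 : 5 / 2 ≤ A0) (hk : a / 8 ≤ k) (hc : 1 / 31 ≤ c)
    (hKm : min (k / 4) (c * (a * A0)) ≤ Km) : a / 32 ≤ Km := by
  rcases min_choice (k / 4) (c * (a * A0)) with h | h <;> rw [h] at hKm
  · linarith
  · nlinarith [mul_le_mul hc (mul_le_mul_of_nonneg_left hA0 ha.le) (by positivity) (by linarith)]

/-- The floor from the slope bound: `a/8 ≤ C₀x_m`, `C₀ ≤ Ψ` ⇒ `x_m ≥ a/(8Ψ)`. -/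
theorem floor_of_slope_bound_alg (a C0 xm Ψ : ℝ) (_ha : 0 < a) (hxm : 0 < xm) (hC0 : 0 < C0) (hk : a / 8 ≤ C0 * xm)
    (hC : C0 ≤ Ψ) : a / (8 * Ψ) ≤ xm := by
  have hΨ : 0 < Ψ := hC0.trans_le hC
  rw [div_le_iff₀ (by positivity)]
  nlinarith [mul_le_mul_of_nonneg_right hC hxm.le]

/-! ### PROPOSITION 32.4 (v): the kernel identity behind NO OVERSHOOT -/

/-- `1/(cos x − cos y) = [cot((y−x)/2) − cot((y+x)/2)]/(2 sin x)`. -/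
theorem inv_cos_sub_cos (x y : ℝ) (hA : Real.sin ((y - x) / 2) ≠ 0) (hB : Real.sin ((y + x) / 2) ≠ 0)
    (hx : Real.sin x ≠ 0) :
    1 / (Real.cos x - Real.cos y)
      = (Real.cos ((y - x) / 2) / Real.sin ((y - x) / 2) - Real.cos ((y + x) / 2) / Real.sin ((y + x) / 2))
          / (2 * Real.sin x) := by
  have h1 : Real.cos x - Real.cos y = 2 * Real.sin ((y - x) / 2) * Real.sin ((y + x) / 2) := by
    rw [Real.cos_sub_cos, show (x + y) / 2 = (y + x) / 2 by ring, show (x - y) / 2 = -((y - x) / 2) by ring,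
      Real.sin_neg]
    ring
  have h2 : Real.sin x = Real.sin ((y + x) / 2) * Real.cos ((y - x) / 2)
      - Real.cos ((y + x) / 2) * Real.sin ((y - x) / 2) := by
    rw [← Real.sin_sub]; congr 1; ring
  rw [eq_div_iff (mul_ne_zero two_ne_zero hx), div_sub_div _ _ hA hB, h1]
  rw [div_mul_eq_mul_div, one_mul, div_eq_div_iff (mul_ne_zero (mul_ne_zero two_ne_zero hA) hB) (mul_ne_zero hA hB)]
  rw [h2]
  ring

/-! ### THEOREM M36, STEP 3: the octave count -/

/-- From `(N − H)·θ/(2aA₀) − H·6A₀/a ≤ M` (`0 < a ≤ 1`, `M ≥ 0`): `N·θ ≤ H·θ + 12·H·A₀² + 2·A₀·M`, i.e. `N ≤ N_max`. -/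
theorem octave_count_alg (N H θ a A0 M : ℝ) (ha : 0 < a) (ha1 : a ≤ 1) (hA0 : 0 < A0) (_hθ : 0 < θ) (_hH : 0 ≤ H)
    (hM : 0 ≤ M) (hineq : (N - H) * (θ / (2 * a * A0)) - H * (6 * A0 / a) ≤ M) :
    N * θ ≤ H * θ + 12 * H * A0 ^ 2 + 2 * A0 * M := by
  have e : (N - H) * (θ / (2 * a * A0)) - H * (6 * A0 / a) = ((N - H) * θ - 12 * H * A0 ^ 2) / (2 * a * A0) := by
    field_simp; ring
  rw [e, div_le_iff₀ (by positivity)] at hineq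
  nlinarith [mul_le_mul_of_nonneg_left ha1 (by positivity : (0:ℝ) ≤ 2 * A0 * M)]

/-! ### §32 typed: LEMMA 32.3 and THEOREM M36 as named statements, and the kernel-checked spines (COROLLARY 32.6 (a):
the ladder in `𝒮`; on `𝒮` the floor for the first critical point ⇔ the chord-slope bound (29.10); M36 ⊇ M35). -/

/-- **LEMMA 32.3, typed (PROVED pen-and-paper, MECHANISM.md §32.3; THE TANGENT REACHES HEIGHT):** for a negative
class-(H) profile with `q₀ = 1` in `𝒮` and its first critical point `x_m`: `F(x_m) ≥ a/32`, and `|f′(0)|·x_m ≥ a/8` in the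
form 'every chord-slope constant `C` (`F ≤ C·sin x` on `(0,π)`) has `C·x_m ≥ a/8`' (in `𝒮` the least such `C` is `|f′(0)|`).
Kernel-checked pieces: `u_slope_alg`, `G_slope_alg` ((32.6)), `one_sub_cos_eq`, `cos_half_sub_cos_eq`, `t1_ratio_le` (T₁ of
(32.7)), `bootstrap_unroll`, `bootstrap_sum_le` ((32.8) unrolled, `Σ ≤ 14.35`), `tangent_height_contra` (STEP 4), `Km_floor_alg`. -/
def TangentHeightStatement (NegP : ℝ → (ℤ → ℂ) → Prop) : Prop :=
  ∀ (a : ℝ) (c : ℤ → ℂ), NegP a c → (1 - a) * HfR c 0 = 1 → 3 / 5 < a → a < 1 → InS c →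
    ∀ xm : ℝ, IsFirstCrit c xm → a / 32 ≤ -fR c xm ∧ ∀ C : ℝ, ChordBound c C → a / 8 ≤ C * xm

/-- **THEOREM 32.5 = THEOREM M36, typed (PROVED pen-and-paper, MECHANISM.md §32.5, by compactness — INEFFECTIVE constant):**
the floor `ξ(a₂,b) > 0` for the first critical point on `𝒮 ∩ {a ≤ a₂ < 1, |Hf(π)| ≥ b > 0}` — QUESTION 31.7 (a): YES.
This is LITERALLY `FirstCritFloorConjecture` of the v25 block (whose docstring 'OPEN' is superseded by this declaration; the
v25 text is left byte-identical).  Kernel-checked pieces of the proof: LEMMA 32.1 (`half_le_tan_half`,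
`x_mul_cos_half_le_two_sin_half`, `kernel_slope_ge_cot_half`, `velocity_upper_alg`, `avg_strain_alg`), LEMMA 32.2
(`octave_growth_alg`, `octave_loss_alg`, `cot_half_ge`, `heavy_count_alg`), THEOREM M36 STEP 3 (`octave_count_alg`),
PROPOSITION 32.4 (v) (`inv_cos_sub_cos`), the floor ⇔ slope-bound algebra (`floor_of_slope_bound_alg`,
`firstCritFloor_of_slopeBoundS`, `slopeBoundS_of_noNeedle_floor`).  NOT formalised: PROPOSITION 32.4 (Helly's selection
principle, the conjugate function of `L¹(𝕋)` data [Kat04, III.2.7], weak limits, the `W^{1,2}` product rule), the integral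
estimates of LEMMAS 32.1–32.3, and the compactness argument of THEOREM M36 itself. -/
def FirstCritFloorStatement (NegP : ℝ → (ℤ → ℂ) → Prop) : Prop := FirstCritFloorConjecture NegP

/-- `FirstCritFloorStatement NegP ↔ FirstCritFloorConjecture NegP` (the statement is the conjecture, by definition). -/
theorem firstCritFloorStatement_iff (NegP : ℝ → (ℤ → ℂ) → Prop) :
    FirstCritFloorStatement NegP ↔ FirstCritFloorConjecture NegP := Iff.rfl

/-- KERNEL-CHECKED (THEOREM M36, 'equivalently'): the chord-slope bound (29.10) on `𝒮` and the tangent height (LEMMA 32.3)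
give the floor `x_m ≥ 3/(40·max(C,1))` for the first critical point. -/
theorem firstCritFloor_of_slopeBoundS {NegP : ℝ → (ℤ → ℂ) → Prop} (h : SlopeBoundSStatement NegP)
    (hT : TangentHeightStatement NegP) : FirstCritFloorConjecture NegP := by
  intro a₂ b ha₂ ha₂' hb
  obtain ⟨C, hC⟩ := h a₂ b ha₂ ha₂' hb
  refine ⟨3 / (40 * max C 1), by positivity, ?_⟩
  intro a c hN hq ha haa hB hS xm hxm
  have hcb : ChordBound c C := hC a c hN hq ha haa hB hS ⟨xm, hxm⟩
  have hk : a / 8 ≤ C * xm := (hT a c hN hq ha (lt_of_le_of_lt haa ha₂') hS xm hxm).2 C hcb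
  have hxm0 : 0 < xm := hxm.1
  have hmax : C * xm ≤ max C 1 * xm := mul_le_mul_of_nonneg_right (le_max_left _ _) hxm0.le
  have hm0 : 0 < max C 1 := lt_of_lt_of_le one_pos (le_max_right _ _)
  rw [div_le_iff₀ (by positivity)]
  nlinarith [hk, hmax, ha]

/-- KERNEL-CHECKED: THEOREM M36 contains THEOREM M35 (`𝒮₁ ⊂ 𝒮`, and a single-crossing profile has a first critical point). -/
theorem slopeBoundS1_of_S {NegP : ℝ → (ℤ → ℂ) → Prop} (h : SlopeBoundSStatement NegP) : SlopeBoundS1Statement NegP := by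
  intro a₂ b ha₂ ha₂' hb
  obtain ⟨C, hC⟩ := h a₂ b ha₂ ha₂' hb
  exact ⟨C, fun a c hN hq ha haa hB hS1 => hC a c hN hq ha haa hB hS1.1 (hS1.2.imp fun _ h => h.1)⟩

/-- **COROLLARY 32.6 (a), KERNEL-CHECKED:** along a branch family with divergent chord slope which is eventually in `𝒮`
(each profile having a first critical point) with `a ≤ a₂ < 1`, THEOREM M36 puts every odd rung `P = 2n+3` on the branch. -/
theorem _root_.Summit.NavierStokesRegularity.OSWSelfSimilar.Mechanism.GlobalBranch.BranchFamily.ladder_in_S {NegP : ℝ → (ℤ → ℂ) → Prop} {β : NNReal} {aσ : ℝ → ℝ} {cσ : ℝ → ℤ → ℂ}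
    (hF : BranchFamily NegP β aσ cσ) (hdiv : ChordSlopeDiverges aσ cσ) (hT : SlopeBoundSStatement NegP)
    (a₂ σ₁ : ℝ) (ha₂ : 3 / 5 < a₂) (ha₂' : a₂ < 1)
    (hev : ∀ σ : ℝ, σ₁ < σ → 0 < σ → aσ σ ≤ a₂ ∧ InS (cσ σ) ∧ ∃ xm : ℝ, IsFirstCrit (cσ σ) xm) (n : ℕ) :
    ∃ σ : ℝ, 0 < σ ∧ NegP (aσ σ) (cσ σ) ∧ (1 - aσ σ) * HfR (cσ σ) 0 = 1 ∧
      HfR (cσ σ) Real.pi = -(1 / (aσ σ * (2 * (n : ℝ) + 3) - 1)) := by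
  apply hF.ladder_of_slope_bound hdiv _ n
  intro b hb
  obtain ⟨C, hC⟩ := hT a₂ b ha₂ ha₂' hb
  refine ⟨|C|, σ₁, fun σ hσ hσ0 hB => ?_⟩
  have hwin := hF.window σ hσ0
  obtain ⟨ha, hS, hex⟩ := hev σ hσ hσ0
  have hcb : ChordBound (cσ σ) C :=
    hC (aσ σ) (cσ σ) (hF.profile σ hσ0) (hF.source σ hσ0) hwin.1 ha hB hS hex
  apply chordBound_mono hcb
  have h1a : 0 < 1 - aσ σ := by linarith [hwin.2]
  have h1b : 1 - aσ σ ≤ 1 := by linarith [hwin.1]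
  calc C ≤ |C| := le_abs_self C
    _ = |C| / 1 := (div_one _).symm
    _ ≤ |C| / (1 - aσ σ) := div_le_div_of_nonneg_left (abs_nonneg C) h1a h1b

/-- **The v26 bundle of this module's §32 block:** the v25 bundle (M34 ∧ M35 ∧ (𝒮_LC ⊂ 𝒮₁) ∧ (22.9)) ∧ LEMMA 32.3 ∧
THEOREM M36 — typed shadows, parametric in `NegP`, all PROVED pen-and-paper. -/
def FirstCritFloorBundle (NegP : ℝ → (ℤ → ℂ) → Prop) : Prop :=
  SourceDefectBundle NegP ∧ TangentHeightStatement NegP ∧ FirstCritFloorStatement NegP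

/-- KERNEL-CHECKED: the v26 bundle gives (29.10) on `𝒮` (v25's `slopeBoundS_of_noNeedle_floor` fed with THEOREM M36). -/
theorem slopeBoundS_of_v26 {NegP : ℝ → (ℤ → ℂ) → Prop} (h26 : FirstCritFloorBundle NegP) : SlopeBoundSStatement NegP :=
  slopeBoundS_of_noNeedle_floor h26.1.1 h26.2.2 h26.1.2.2.2

/-- **v26 headline reduction (kernel-checked):** with the v24 bundle, M33's divergence holds on a branch family for every
`β`, and an eventually-MONOTONE tail (`f(σ) ∈ 𝒮` with a first critical point, `a ≤ a₂ < 1`) carries EVERY rung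
(COROLLARY 32.6 (a)); (29.10) holds on `𝒮` (THEOREM M36) and on `𝒮₁` (M35 as a corollary); and on `𝒮` the floor for the
first critical point and (29.10) are EQUIVALENT given M34, (22.9) and LEMMA 32.3 (both directions kernel-checked). -/
theorem ladder_of_v26 {NegP : ℝ → (ℤ → ℂ) → Prop} (h24 : ChordSlopeBundle NegP) (h26 : FirstCritFloorBundle NegP) :
    (∀ β : NNReal, 0 < β → β < 1 → ∃ (aσ : ℝ → ℝ) (cσ : ℝ → ℤ → ℂ), BranchFamily NegP β aσ cσ ∧
      ChordSlopeDiverges aσ cσ ∧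
      ∀ a₂ σ₁ : ℝ, 3 / 5 < a₂ → a₂ < 1 →
        (∀ σ : ℝ, σ₁ < σ → 0 < σ → aσ σ ≤ a₂ ∧ InS (cσ σ) ∧ ∃ xm : ℝ, IsFirstCrit (cσ σ) xm) →
        ∀ n : ℕ, ∃ σ : ℝ, 0 < σ ∧ NegP (aσ σ) (cσ σ) ∧ (1 - aσ σ) * HfR (cσ σ) 0 = 1 ∧
          HfR (cσ σ) Real.pi = -(1 / (aσ σ * (2 * (n : ℝ) + 3) - 1))) ∧
    SlopeBoundSStatement NegP ∧ SlopeBoundS1Statement NegP ∧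
    (SlopeBoundSStatement NegP ↔ FirstCritFloorConjecture NegP) := by
  have hS : SlopeBoundSStatement NegP := slopeBoundS_of_v26 h26
  refine ⟨?_, hS, slopeBoundS1_of_S hS,
    ⟨fun h => firstCritFloor_of_slopeBoundS h h26.2.1, fun hξ => slopeBoundS_of_noNeedle_floor h26.1.1 hξ h26.1.2.2.2⟩⟩
  intro β hβ0 hβ1
  obtain ⟨aσ, cσ, hF, hdiv⟩ := chordSlopeDivergence_of h24.2.2.2 h24.1 β hβ0 hβ1
  exact ⟨aσ, cσ, hF, hdiv, fun a₂ σ₁ ha₂ ha₂' hev n => hF.ladder_in_S hdiv hS a₂ σ₁ ha₂ ha₂' hev n⟩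

end Summit.NavierStokesRegularity.OSWSelfSimilar.Mechanism.FirstCritFloor


/-! ## §33 (v27): the effective floor — LEMMA 33.1 (strain and height beyond a scale), LEMMA 33.2 (a light octave),
LEMMA 33.3 (transport on the body; the fence), LEMMA 33.4 (the sink strain from the body height), THEOREM M37
(quantitative rigidity under small unspent budget), THEOREM M38 (EFFECTIVE M36; QUESTION 32.8 (b): YES), COROLLARY 33.7
(the explicit floor), LEMMA 33.8 (the endpoints of `χ ≤ 0` are strict), REMARK 33.9, QUESTION 33.10 (MECHANISM.md v27 §33).
1-D model (gCLM/OSW), computer-assisted; not Euler/NS. -/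

namespace Summit.NavierStokesRegularity.OSWSelfSimilar.Mechanism.EffectiveFloor

open Summit.NavierStokesRegularity.OSWSelfSimilar.Mechanism.GlobalBranch Summit.NavierStokesRegularity.OSWSelfSimilar.Mechanism.ChordSlope Summit.NavierStokesRegularity.OSWSelfSimilar.Mechanism.SourceDefect
open Summit.NavierStokesRegularity.OSWSelfSimilar.Mechanism.FirstCritFloor
open Set

/-! ### LEMMA 33.1: strain and height beyond a scale -/

/-- LEMMA 33.1 (a)/(b), the bookkeeping: from (32.1) `h ≤ R(x) + x·G/π`, `R(x) = R(ε) − I` with the spent budget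
`I = (1/π)∫_ε^x G ≥ (x−ε)·G(x)/π` (`G` non-increasing) and `I ≤ R(ε)`: `h ≤ R(ε) + ε·G/π`, `G ≤ π·R(ε)/(x−ε)`, and
`h ≤ R(ε)·x/(x−ε)`. -/
theorem strain_beyond_alg (h Rx Re I G x ε : ℝ) (hε : 0 < ε) (hεx : ε < x)
    (h321 : h ≤ Rx + x * G / Real.pi) (hR : Rx = Re - I) (hI : (x - ε) * G / Real.pi ≤ I) (hIR : I ≤ Re) :
    h ≤ Re + ε * G / Real.pi ∧ G ≤ Real.pi * Re / (x - ε) ∧ h ≤ Re * x / (x - ε) := by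
  have hπ : 0 < Real.pi := Real.pi_pos
  have hxe : 0 < x - ε := by linarith
  have hne : x - ε ≠ 0 := ne_of_gt hxe
  have h1 : h ≤ Re + ε * G / Real.pi := by
    have e : x * G / Real.pi = (x - ε) * G / Real.pi + ε * G / Real.pi := by ring
    linarith
  have hI' : (x - ε) * G ≤ Re * Real.pi := (div_le_iff₀ hπ).1 (le_trans hI hIR)
  have h2 : G ≤ Real.pi * Re / (x - ε) := by
    rw [le_div_iff₀ hxe]; linarith
  refine ⟨h1, h2, ?_⟩
  have h3 : ε * G / Real.pi ≤ ε * Re / (x - ε) := by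
    rw [div_le_iff₀ hπ]
    have := mul_le_mul_of_nonneg_left h2 hε.le
    calc ε * G ≤ ε * (Real.pi * Re / (x - ε)) := this
      _ = ε * Re / (x - ε) * Real.pi := by ring
  have h4 : Re + ε * Re / (x - ε) = Re * x / (x - ε) := by field_simp; ring
  linarith [h3, h4]

/-- LEMMA 33.1 (c): if `R(ε) ≤ 1 + δ`, `L > 1` and `x ≥ Lε`, then `h − 1 ≤ (1 + Lδ)/(L − 1) =: δ′`. -/
theorem delta_prime_alg (h Re δ L ε x : ℝ) (hε : 0 < ε) (hL : 1 < L) (hx : L * ε ≤ x) (hRe : 0 ≤ Re)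
    (hRδ : Re ≤ 1 + δ) (hh : h ≤ Re * x / (x - ε)) : h - 1 ≤ (1 + L * δ) / (L - 1) := by
  have hxe : 0 < x - ε := by nlinarith
  have hL1 : 0 < L - 1 := by linarith
  have hne : L - 1 ≠ 0 := ne_of_gt hL1
  have h1 : Re * x / (x - ε) ≤ Re * L / (L - 1) := by
    rw [div_le_div_iff₀ hxe hL1]
    nlinarith [mul_nonneg hRe (by linarith : (0:ℝ) ≤ x - L * ε)]
  have h2 : Re * L / (L - 1) ≤ (1 + δ) * L / (L - 1) :=
    div_le_div_of_nonneg_right (by nlinarith) hL1.le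
  have h3 : (1 + δ) * L / (L - 1) - 1 = (1 + L * δ) / (L - 1) := by field_simp; ring
  linarith [h1, h2, h3]

/-! ### LEMMA 33.2: a light octave -/

/-- Pigeonhole: among `J ≥ 1` octaves whose budgets sum to at most `S`, one octave has budget `≤ S/J`. -/
theorem light_octave_exists (J : ℕ) (hJ : 0 < J) (β : ℕ → ℝ) (S : ℝ)
    (hsum : ∑ j ∈ Finset.range J, β j ≤ S) : ∃ j, j < J ∧ β j ≤ S / J := by
  by_contra hcon
  push Not at hcon
  have hlt : ∑ j ∈ Finset.range J, S / J < ∑ j ∈ Finset.range J, β j := by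
    apply Finset.sum_lt_sum_of_nonempty
    · exact ⟨0, Finset.mem_range.2 hJ⟩
    · intro j hj; exact hcon j (Finset.mem_range.1 hj)
  rw [Finset.sum_const, Finset.card_range, nsmul_eq_mul] at hlt
  have hJr : (J : ℝ) ≠ 0 := by exact_mod_cast hJ.ne'
  have e : (J : ℝ) * (S / J) = S := by field_simp
  linarith

/-- `tan x ≤ (32/31)·x` on `(0, 1/4]` (`cos x ≥ 1 − x²/2 ≥ 31/32`, `sin x ≤ x`). -/
theorem tan_le_on_quarter (x : ℝ) (h0 : 0 < x) (h1 : x ≤ 1 / 4) : Real.tan x ≤ 32 / 31 * x := by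
  have hx2 : x ^ 2 ≤ 1 / 16 := by nlinarith
  have hc : 31 / 32 ≤ Real.cos x := by
    have := Real.one_sub_sq_div_two_le_cos (x := x)
    linarith
  have hcpos : 0 < Real.cos x := by linarith
  have hs : Real.sin x ≤ x := Real.sin_le h0.le
  rw [Real.tan_eq_sin_div_cos, div_le_iff₀ hcpos]
  nlinarith [mul_nonneg h0.le (by linarith : (0:ℝ) ≤ 32 / 31 * Real.cos x - 1)]

/-- LEMMA 33.2 (b): at the light octave `[x₁, 2x₁]` (`x₁ ≤ 1/4`, budget `≤ S/J`): `G(2x₁)·x₁ ≤ π·S/J` and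
`F(2x₁) = G(2x₁)·tan x₁` give `F(2x₁) ≤ (32/31)·π·S/J ≤ 3.26·S/J`. -/
theorem light_height_alg (F2 G2 x₁ S : ℝ) (J : ℕ) (hJ : 0 < J) (hx : 0 < x₁) (hx4 : x₁ ≤ 1 / 4) (hS : 0 ≤ S)
    (hG : 0 ≤ G2) (hGx : G2 * x₁ ≤ Real.pi * (S / J)) (hF : F2 = G2 * Real.tan x₁) : F2 ≤ 3.26 * S / J := by
  have ht := tan_le_on_quarter x₁ hx hx4
  have hπ := Real.pi_lt_d2
  have hJr : (0:ℝ) < J := by exact_mod_cast hJ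
  have hSJ : 0 ≤ S / J := div_nonneg hS hJr.le
  have h1 : F2 ≤ G2 * (32 / 31 * x₁) := by rw [hF]; exact mul_le_mul_of_nonneg_left ht hG
  have h2 : G2 * (32 / 31 * x₁) ≤ 32 / 31 * (Real.pi * (S / J)) := by linarith
  have h3 : 32 / 31 * Real.pi ≤ 3.26 := by linarith
  have h4 : 32 / 31 * (Real.pi * (S / J)) ≤ 3.26 * (S / J) := by
    calc 32 / 31 * (Real.pi * (S / J)) = (32 / 31 * Real.pi) * (S / J) := by ring
      _ ≤ 3.26 * (S / J) := mul_le_mul_of_nonneg_right h3 hSJ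
  calc F2 ≤ 3.26 * (S / J) := by linarith
    _ = 3.26 * S / J := by ring

/-! ### LEMMA 33.3: transport on the body; the fence -/

/-- The transport integrand on the body: `h − 1 ≤ δ′` (`δ′ ≥ 0`), `g ≥ s/2 > 0`, `a > 0` ⇒ `(h − 1)/(a·g) ≤ 2δ′/(a·s)`. -/
theorem transport_integrand_le (h δ' g s a : ℝ) (ha : 0 < a) (hs : 0 < s) (hδ : 0 ≤ δ') (hh : h - 1 ≤ δ')
    (hg : s / 2 ≤ g) : (h - 1) / (a * g) ≤ 2 * δ' / (a * s) := by
  have hgpos : 0 < g := by linarith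
  rw [div_le_div_iff₀ (by positivity) (by positivity)]
  have e1 : (h - 1) * (a * s) ≤ δ' * (a * s) := mul_le_mul_of_nonneg_right hh (by positivity)
  have e2 : δ' * (a * s) ≤ δ' * (a * (2 * g)) := by
    apply mul_le_mul_of_nonneg_left _ hδ
    exact mul_le_mul_of_nonneg_left (by linarith) ha.le
  linarith [e1, e2]

/-- The exponent bookkeeping of THEOREM M37: with `δ = 1/L` and `L ≥ 1 + (4/a)·ℓ` (`ℓ = log(π/(2ε)) > 0`):
`δ′ = (1 + L·(1/L))/(L − 1) = 2/(L − 1)` and `2δ′/a ≤ 1/ℓ`. -/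
theorem exponent_alg (a L ℓ : ℝ) (ha : 0 < a) (hℓ : 0 < ℓ) (hL : 1 + 4 / a * ℓ ≤ L) :
    (1 + L * (1 / L)) / (L - 1) = 2 / (L - 1) ∧ 2 * (2 / (L - 1)) / a ≤ 1 / ℓ := by
  have h4 : 0 < 4 / a * ℓ := by positivity
  have hL1 : 0 < L - 1 := by linarith
  have hne : L - 1 ≠ 0 := ne_of_gt hL1
  have hL0 : L ≠ 0 := by linarith
  have ha0 : a ≠ 0 := ne_of_gt ha
  constructor
  · rw [mul_one_div_cancel hL0]; norm_num
  · rw [div_le_div_iff₀ ha hℓ]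
    have hle : 4 / a * ℓ ≤ L - 1 := by linarith
    have h2 : 4 * ℓ ≤ a * (L - 1) := by
      have := mul_le_mul_of_nonneg_left hle ha.le
      calc 4 * ℓ = a * (4 / a * ℓ) := by field_simp
        _ ≤ a * (L - 1) := this
    calc 2 * (2 / (L - 1)) * ℓ = 4 * ℓ / (L - 1) := by ring
      _ ≤ a * (L - 1) / (L - 1) := div_le_div_of_nonneg_right h2 hL1.le
      _ = 1 * a := by field_simp

/-- `z^t ≤ e` when `1 ≤ z ≤ Z`, `1 < Z`, `0 ≤ t ≤ 1/log Z` (used with `z = π/(2x₁)`, `Z = π/(2ε)`, `t = 2δ′/a`):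
TRANSPORT ON THE BODY AMPLIFIES THE LIGHT OCTAVE'S HEIGHT BY AT MOST `e`. -/
theorem rpow_le_exp_one (z Z t : ℝ) (hz : 1 ≤ z) (hzZ : z ≤ Z) (hZ : 1 < Z) (ht : 0 ≤ t)
    (htZ : t ≤ 1 / Real.log Z) : z ^ t ≤ Real.exp 1 := by
  have hzpos : 0 < z := by linarith
  have hlogZ : 0 < Real.log Z := Real.log_pos hZ
  have hne : Real.log Z ≠ 0 := ne_of_gt hlogZ
  rw [Real.rpow_def_of_pos hzpos, Real.exp_le_exp]
  have hlz : 0 ≤ Real.log z := Real.log_nonneg hz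
  have hlzZ : Real.log z ≤ Real.log Z := Real.log_le_log hzpos hzZ
  calc Real.log z * t ≤ Real.log Z * (1 / Real.log Z) := mul_le_mul hlzZ htZ ht hlogZ.le
    _ = 1 := by field_simp

/-- THEOREM M37, the height of the body: `F(2x₁) ≤ 3.26·(3/2)/J` (light octave, `R(ε) ≤ 3/2`) and amplification `≤ e`
give `s₁ ≤ 13.3/J`; `J ≥ 18` puts `s₁ < π/4`. -/
theorem body_height_alg (F2 P s₁ : ℝ) (J : ℕ) (hJ : 18 ≤ J) (hF : F2 ≤ 3.26 * (3 / 2) / J)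
    (hP : 0 ≤ P) (hPe : P ≤ Real.exp 1) (hs : s₁ = F2 * P) : s₁ ≤ 13.3 / J ∧ s₁ < Real.pi / 4 := by
  have he := Real.exp_one_lt_d9
  have hπ := Real.pi_gt_d2
  have hJr : (18:ℝ) ≤ J := by exact_mod_cast hJ
  have hJpos : (0:ℝ) < J := by linarith
  have h1 : s₁ ≤ 3.26 * (3 / 2) / J * Real.exp 1 := by
    rw [hs]; exact mul_le_mul hF hPe hP (by positivity)
  have h2 : 3.26 * (3 / 2) / J * Real.exp 1 ≤ 13.3 / J := by
    have hnum : 3.26 * (3 / 2) * Real.exp 1 ≤ 13.3 := by nlinarith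
    calc 3.26 * (3 / 2) / J * Real.exp 1 = (3.26 * (3 / 2) * Real.exp 1) / J := by ring
      _ ≤ 13.3 / J := div_le_div_of_nonneg_right hnum hJpos.le
  have h3 : (13.3:ℝ) / J ≤ 13.3 / 18 := div_le_div_of_nonneg_left (by norm_num) (by norm_num) hJr
  constructor
  · linarith
  · have h4 : (13.3:ℝ) / 18 < Real.pi / 4 := by linarith
    linarith

/-- LEMMA 33.3 (iii), the local step: under (32.1) `h ≤ R + (2/π)F`, `R ≤ 1/2`, `F ≤ s₁ < π/4`: `h < 1`, and then the
transport law `F′ = F(h − 1)/(a·g)` (`F, a, g > 0`) gives `F′ < 0`. -/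
theorem tail_slope_neg (h R F F' s₁ a g : ℝ) (ha : 0 < a) (hg : 0 < g) (hF : 0 < F)
    (h321 : h ≤ R + 2 / Real.pi * F) (hR : R ≤ 1 / 2) (hFs : F ≤ s₁) (hs : s₁ < Real.pi / 4)
    (hT1 : F' = F * (h - 1) / (a * g)) : h < 1 ∧ F' < 0 := by
  have hπ : 0 < Real.pi := Real.pi_pos
  have h1 : 2 / Real.pi * F < 1 / 2 := by
    rw [div_mul_eq_mul_div, div_lt_iff₀ hπ]; nlinarith
  have hh : h < 1 := by linarith
  refine ⟨hh, ?_⟩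
  rw [hT1]
  exact div_neg_of_neg_of_pos (by nlinarith [mul_pos hF (by linarith : (0:ℝ) < 1 - h)]) (by positivity)

end Summit.NavierStokesRegularity.OSWSelfSimilar.Mechanism.EffectiveFloor
end
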